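import Mathlib
import HarnessLib
import Summits.HubbardSuperconductivity.HubbardSuperconductivity.Theorems.KLProgrammeKLRegimeTwoVolumeTowerBaseTransfer

/-!
# Route `KLProgramme` — crux K3, VL child `KLRegimeVolumeLimitV17F2` (stmt-HubbardSuperconductivity-20440), blueprint v5 M5 / W4c: THE BASE OF THE SPINE —
# the keyed defect of the step-`0` states tends to zero (seat hubbard-kl-k3c4-p1 g13; `--supports` 20440)

The BASE hypothesis `h0` of `…TwoVolumeTowerSpine.tower_keyedDefect_eventually_le` (field `h0` of `TowerData`) from GRID-LEVEL data: if the keyed defect of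
the two volumes' UV-stepped grid actions `(klGridAction (bL) … K_{bL}, klGridAction L … K_L)` at the `r_L`-deep grid pins tends to zero uniformly in the
admissible instance (the two-volume step at scale `0`, M4a `…TwoVolumeScaleZeroTopFrame` with the fine covariance frame swap — supplied separately), the
grid actions carry `Λg`-weighted raw profiles `ε·NG`, the fine base transfer at the coarse frame has `Λ_T`-scaled rows/columns `cW` and is block covariant,
and its mismatch against the own frame has rows/columns `δ_L → 0`, THEN the keyed defect of the step-`0` states `(klTowerState (bL) … 0, klTowerState L … 0)`
at the `2r_L`-deep pins tends to zero uniformly, in every degree (`…TowerBaseTransfer.tower_base_keyedDefect_le` with tail radius `r_L/3`).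

* `tendsto_div_const_atTop_nat` — `r_L/3 → ∞`;
* **`tower_base_keyedDefect_eventually_le`**.

Proofs only; no definition.
-/

noncomputable section

namespace Summit.HubbardSuperconductivity.HubbardSuperconductivity.Theorems.TwoVolumeSource

set_option linter.dupNamespace false -- summit = problem name (single-conjunct summit), D-0017

open Finset Filter Topology Literature.MathematicalPhysics.QuantumLattice GrassmannAlgebra Literature.Probability.LatticeModels
  Literature.Probability.LatticeModels.BattleFederbush
open Summit.HubbardSuperconductivity.HubbardSuperconductivity.Theorems.TwoPointAssembly
open Summit.HubbardSuperconductivity.HubbardSuperconductivity.Theorems.KLRegimeSplit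
open Summit.HubbardSuperconductivity.HubbardSuperconductivity.Theorems.KLProgrammeLegKernels
open Summit.HubbardSuperconductivity.HubbardSuperconductivity.Theorems.EngineV8
open Summit.HubbardSuperconductivity.HubbardSuperconductivity.Theorems.TwoVolumeDefect

/-- `r_L / 3 → ∞` when `r_L → ∞`. [folklore] -/
theorem tendsto_div_const_atTop_nat {r : ℕ → ℕ} (hr : Tendsto r atTop atTop) : Tendsto (fun L => r L / 3) atTop atTop := by
  rw [tendsto_atTop_atTop]
  intro B
  obtain ⟨N, hN⟩ := (tendsto_atTop_atTop.1 hr) (3 * B)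
  exact ⟨N, fun L hL => (Nat.le_div_iff_mul_le (by norm_num)).2 (by have := hN L hL; linarith)⟩

set_option maxHeartbeats 400000 in -- the limit bookkeeping
/-- **THE BASE OF THE SPINE** (see the module docstring). [folklore: Tannery bookkeeping; cite: BenfattoGiulianiMastropietro2006, §2.7 (2.70)-(2.71), §3] -/
theorem tower_base_keyedDefect_eventually_le (β U μ : ℝ) (hβ : β ≠ 0) (Kfr : ℕ → ℕ → TrigPolyC4v) (Adm : ℕ → ℕ → ℕ → Prop) (ε : ℕ → ℝ)
    (hε : ∀ L b M, Adm L b M → 0 < ε M) (r : ℕ → ℕ) (hr : Tendsto r atTop atTop)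
    {ΛT cW Λg δb : ℝ} (hΛT : 0 < ΛT) (hcW : 0 ≤ cW) (hΛg : 0 < Λg) (NG : ℕ → ℝ) (hNG0 : ∀ k, 0 ≤ NG k)
    (δ : ℕ → ℝ) (hδ : ∀ L, 0 ≤ δ L ∧ δ L ≤ δb) (hδ0 : Tendsto δ atTop (𝓝 0))
    -- the base data, eventually in `L`, at every admissible instance
    (hdata : ∀ᶠ L in atTop, ∀ (b M : ℕ) [NeZero L] [NeZero (b * L)] [NeZero M], Adm L b M →
      (∀ x : SrcLabel (b * L) M 0, ∑ y, ‖klBaseTransfer (b * L) M β μ (Kfr L M) x y‖ * (1 + ΛT * (Torus.tnorm (x.1.1.2 - y.1.1.1.2) : ℝ)) ≤ cW) ∧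
      (∀ y : GridLeg (GridPoint (b * L) (klGridN M)) × Fin 2, ∑ x, ‖klBaseTransfer (b * L) M β μ (Kfr L M) x y‖ * (1 + ΛT * (Torus.tnorm (x.1.1.2 - y.1.1.1.2) : ℝ)) ≤ cW) ∧
      (∀ (δ' β' β₁ : Fin 2 → Fin b) (xbar : SrcLabel L M 0) (y : GridLeg (GridPoint L (klGridN M)) × Fin 2),
        ‖klBaseTransfer (b * L) M β μ (Kfr L M) ((klBlockEquivD L b M 0).symm (β' + δ', xbar)) ((klGridBlockEquivD L b M).symm (β₁ + δ', y))‖ =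
          ‖klBaseTransfer (b * L) M β μ (Kfr L M) ((klBlockEquivD L b M 0).symm (β', xbar)) ((klGridBlockEquivD L b M).symm (β₁, y))‖) ∧
      (∀ x, ∑ y, ‖klBaseTransfer (b * L) M β μ (Kfr (b * L) M) x y - klBaseTransfer (b * L) M β μ (Kfr L M) x y‖ ≤ δ L) ∧
      (∀ y, ∑ x, ‖klBaseTransfer (b * L) M β μ (Kfr (b * L) M) x y - klBaseTransfer (b * L) M β μ (Kfr L M) x y‖ ≤ δ L) ∧
      (∀ (k : ℕ) (p : Fin k) (y : GridLeg (GridPoint L (klGridN M))),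
        ∑ Y ∈ univ.filter (fun Y : Fin k → GridLeg (GridPoint L (klGridN M)) => Y p = y),
          ‖kernel ℂ (klGridAction L M β U μ (Kfr L M)) k Y‖ *
            (1 + labelDiam (fun Y₁ Y₂ : GridLeg (GridPoint L (klGridN M)) => Λg * (Torus.tnorm (Y₁.1.1.2 - Y₂.1.1.2) : ℝ)) (univ.image Y)) ≤ ε M * NG k) ∧
      (∀ (k : ℕ) (p : Fin k) (y : GridLeg (GridPoint (b * L) (klGridN M))),
        ∑ Y ∈ univ.filter (fun Y : Fin k → GridLeg (GridPoint (b * L) (klGridN M)) => Y p = y),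
          ‖kernel ℂ (klGridAction (b * L) M β U μ (Kfr (b * L) M)) k Y‖ *
            (1 + labelDiam (fun Y₁ Y₂ : GridLeg (GridPoint (b * L) (klGridN M)) => Λg * (Torus.tnorm (Y₁.1.1.2 - Y₂.1.1.2) : ℝ)) (univ.image Y)) ≤ ε M * NG k))
    -- the grid-level base: the keyed defect of the two UV-stepped grid actions at the `r_L`-deep grid pins tends to zero uniformly
    (hgrid : ∀ (k : ℕ) (η : ℝ), 0 < η → ∀ᶠ L in atTop, ∀ (b M : ℕ) [NeZero L] [NeZero (b * L)] [NeZero M], Adm L b M →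
      ∀ (p' : Fin k) (y' : GridLeg (GridPoint (b * L) (klGridN M))), (∀ i, r L ≤ (y'.1.1.2 i).val % L ∧ (y'.1.1.2 i).val % L + r L < L) →
        ∑ Y' ∈ univ.filter (fun Y' : Fin k → GridLeg (GridPoint (b * L) (klGridN M)) => Y' p' = y'),
          ‖kernel ℂ (klGridAction (b * L) M β U μ (Kfr (b * L) M)) k Y' -
            (if ∀ i, (klGridBlockEquiv L b M (Y' i)).1 = (klGridBlockEquiv L b M (Y' p')).1 then
              kernel ℂ (klGridAction L M β U μ (Kfr L M)) k (fun i => (klGridBlockEquiv L b M (Y' i)).2) else 0)‖ ≤ ε M * η) :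
    ∀ (k : ℕ) (η : ℝ), 0 < η → ∀ᶠ L in atTop, ∀ (b M : ℕ) [NeZero L] [NeZero (b * L)] [NeZero M], Adm L b M →
      ∀ (p : Fin k) (w : SrcLabel (b * L) M 0), (∀ i, 2 * r L ≤ (w.1.1.2 i).val % L ∧ (w.1.1.2 i).val % L + 2 * r L < L) →
        klKeyedDefect L b M β U μ (Kfr L M) (Kfr (b * L) M) 0 k p w ≤ ε M * η := by
  classical
  intro k η hη
  rcases k with _ | n
  · exact Eventually.of_forall fun L b M _ _ _ _ p => p.elim0
  have hδb : 0 ≤ δb := (hδ 0).1.trans (hδ 0).2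
  -- the majorant: `η′` in degree `n+1` (grid base), the everywhere bound elsewhere
  set η' : ℝ := η / (2 * (2 ^ (n + 1) * cW ^ (n + 1) + 1)) with hη'
  have hcp : 0 < 2 ^ (n + 1) * cW ^ (n + 1) + 1 := by positivity
  have hη'0 : 0 < η' := by positivity
  have hη'le : 2 ^ (n + 1) * cW ^ (n + 1) * η' ≤ η / 2 :=
    calc 2 ^ (n + 1) * cW ^ (n + 1) * η' ≤ (2 ^ (n + 1) * cW ^ (n + 1) + 1) * η' := by nlinarith [hη'0.le]
      _ = η / 2 := by rw [hη']; field_simp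
  -- the vanishing part (tail radius `r_L / 3`)
  have hr3 := tendsto_div_const_atTop_nat hr
  set G : ℕ → ℝ := fun L => 2 ^ (n + 1) * (((n : ℝ) + 1) * (cW + δb) ^ n * NG (n + 1) * δ L +
      (cW ^ n * (NG (n + 1) + NG (n + 1)) * (cW / (1 + ΛT * (((r L / 3 : ℕ) : ℝ) + 1))) +
        2 * cW ^ n * NG (n + 1) * (cW / (1 + ΛT * (((r L / 3 : ℕ) : ℝ) + 1))) +
          (n : ℝ) * cW ^ n * (5 * NG (n + 1) * (cW / (1 + ΛT * (((r L / 3 : ℕ) : ℝ) + 1))) +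
            2 * cW * NG (n + 1) * (1 + Λg * (((r L / 3 : ℕ) : ℝ) + 1))⁻¹))) with hG
  have hτ := tendsto_const_div_one_add_mul_atTop_nat hΛT cW hr3
  have hinv := tendsto_inv_one_add_mul_atTop_nat hΛg hr3
  have hG0 : Tendsto G atTop (𝓝 0) := by
    have h := ((hδ0.const_mul (((n : ℝ) + 1) * (cW + δb) ^ n * NG (n + 1))).add
      (((hτ.const_mul (cW ^ n * (NG (n + 1) + NG (n + 1)))).add (hτ.const_mul (2 * cW ^ n * NG (n + 1)))).add
        (((hτ.const_mul (5 * NG (n + 1))).add (hinv.const_mul (2 * cW * NG (n + 1)))).const_mul ((n : ℝ) * cW ^ n)))).const_mul ((2 : ℝ) ^ (n + 1))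
    simp only [mul_zero, add_zero] at h
    exact h
  have hGev : ∀ᶠ L in atTop, G L ≤ η / 2 := hG0.eventually (ge_mem_nhds (half_pos hη))
  filter_upwards [hgrid (n + 1) η' hη'0, hGev, hdata] with L hgr hGL hdat
  intro b M iL ibL iM hA p w hw
  obtain ⟨hrowT, hcolT, hcovT, htrow, htcol, hNc, hNf⟩ := hdat b M hA
  have hεM := hε L b M hA
  obtain ⟨hδL0, hδLb⟩ := hδ L
  -- the grid majorant at the `(2r_L − r_L/3)`-deep grid pins
  have hEg : ∀ (k : ℕ) (p' : Fin k) (y' : GridLeg (GridPoint (b * L) (klGridN M))),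
      (∀ i, 2 * r L - r L / 3 ≤ (y'.1.1.2 i).val % L ∧ (y'.1.1.2 i).val % L + (2 * r L - r L / 3) < L) →
        ∑ Y' ∈ univ.filter (fun Y' : Fin k → GridLeg (GridPoint (b * L) (klGridN M)) => Y' p' = y'),
          ‖kernel ℂ (klGridAction (b * L) M β U μ (Kfr (b * L) M)) k Y' -
            (if ∀ i, (klGridBlockEquiv L b M (Y' i)).1 = (klGridBlockEquiv L b M (Y' p')).1 then
              kernel ℂ (klGridAction L M β U μ (Kfr L M)) k (fun i => (klGridBlockEquiv L b M (Y' i)).2) else 0)‖ ≤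
          ε M * (if k = n + 1 then η' else NG k + NG k) := by
    intro k p' y' hy'
    split_ifs with hk
    · subst hk
      exact hgr b M hA p' y' fun i => by have h := hy' i; constructor <;> omega
    · rw [mul_add]
      exact sum_filter_norm_keyedGlued_le_of_profiles (klGridBlockEquiv L b M) _ _ p' y'
        (sum_filter_norm_kernel_le_of_weighted _ k p' y' _
          (fun Y => by have := labelDiam_nonneg (fun Y₁ Y₂ : GridLeg (GridPoint (b * L) (klGridN M)) => Λg * (Torus.tnorm (Y₁.1.1.2 - Y₂.1.1.2) : ℝ)) (univ.image Y); linarith)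
          (hNf k p' y'))
        (sum_filter_norm_kernel_le_of_weighted _ k p' _ _
          (fun Y => by have := labelDiam_nonneg (fun Y₁ Y₂ : GridLeg (GridPoint L (klGridN M)) => Λg * (Torus.tnorm (Y₁.1.1.2 - Y₂.1.1.2) : ℝ)) (univ.image Y); linarith)
          (hNc k p' _))
  have hbase := tower_base_keyedDefect_le β U μ hβ (Kfr L M) (Kfr (b * L) M) hεM hΛT.le hcW hrowT hcolT hcovT hδL0 htrow htcol hΛg.le NG hNG0 hNc hNf
    (2 * r L - r L / 3) (r L / 3) (by omega) (fun k => if k = n + 1 then η' else NG k + NG k)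
    (fun k => by show 0 ≤ (if k = n + 1 then η' else NG k + NG k); split_ifs; exacts [hη'0.le, add_nonneg (hNG0 k) (hNG0 k)]) hEg n p w
    (fun i => by have h := hw i; constructor <;> omega)
  simp only [if_true] at hbase
  refine hbase.trans ?_
  -- `ε·2^{n+1}·(swap + tb) ≤ ε·(2^{n+1} cW^{n+1} η′ + G L) ≤ ε·η`
  have hNS := hNG0 (n + 1)
  have hτ0 : 0 ≤ cW / (1 + ΛT * (((r L / 3 : ℕ) : ℝ) + 1)) := by have := hΛT.le; positivity
  have hswap_le : ((n : ℝ) + 1) * (cW + δ L) ^ n * δ L * NG (n + 1) ≤ ((n : ℝ) + 1) * (cW + δb) ^ n * NG (n + 1) * δ L := by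
    have hp : (cW + δ L) ^ n ≤ (cW + δb) ^ n := pow_le_pow_left₀ (add_nonneg hcW hδL0) (by linarith) n
    calc ((n : ℝ) + 1) * (cW + δ L) ^ n * δ L * NG (n + 1) = (((n : ℝ) + 1) * δ L * NG (n + 1)) * (cW + δ L) ^ n := by ring
      _ ≤ (((n : ℝ) + 1) * δ L * NG (n + 1)) * (cW + δb) ^ n := mul_le_mul_of_nonneg_left hp (by positivity)
      _ = ((n : ℝ) + 1) * (cW + δb) ^ n * NG (n + 1) * δ L := by ring
  have hle : 2 ^ (n + 1) * (((n : ℝ) + 1) * (cW + δ L) ^ n * δ L * NG (n + 1) +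
      (cW ^ n * (cW * η' + cW / (1 + ΛT * (((r L / 3 : ℕ) : ℝ) + 1)) * (NG (n + 1) + NG (n + 1))) +
        (2 * cW ^ n * (cW / (1 + ΛT * (((r L / 3 : ℕ) : ℝ) + 1))) * NG (n + 1) +
          (n : ℝ) * cW ^ n * (5 * (cW / (1 + ΛT * (((r L / 3 : ℕ) : ℝ) + 1))) * NG (n + 1) +
            2 * cW * ((1 + Λg * (((r L / 3 : ℕ) : ℝ) + 1))⁻¹ * NG (n + 1)))))) ≤ 2 ^ (n + 1) * cW ^ (n + 1) * η' + G L := by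
    have hid : 2 ^ (n + 1) * cW ^ (n + 1) * η' + G L = 2 ^ (n + 1) * (((n : ℝ) + 1) * (cW + δb) ^ n * NG (n + 1) * δ L +
        (cW ^ n * (cW * η' + cW / (1 + ΛT * (((r L / 3 : ℕ) : ℝ) + 1)) * (NG (n + 1) + NG (n + 1))) +
          (2 * cW ^ n * (cW / (1 + ΛT * (((r L / 3 : ℕ) : ℝ) + 1))) * NG (n + 1) +
            (n : ℝ) * cW ^ n * (5 * (cW / (1 + ΛT * (((r L / 3 : ℕ) : ℝ) + 1))) * NG (n + 1) +
              2 * cW * ((1 + Λg * (((r L / 3 : ℕ) : ℝ) + 1))⁻¹ * NG (n + 1)))))) := by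
      simp only [hG]; ring
    rw [hid]
    have h2 : (0 : ℝ) ≤ 2 ^ (n + 1) := by positivity
    nlinarith [hswap_le, h2]
  have h2 : 2 ^ (n + 1) * cW ^ (n + 1) * η' + G L ≤ η := by linarith [hη'le, hGL]
  calc ε M * 2 ^ (n + 1) * _ = ε M * (2 ^ (n + 1) * _) := by ring
    _ ≤ ε M * (2 ^ (n + 1) * cW ^ (n + 1) * η' + G L) := mul_le_mul_of_nonneg_left hle hεM.le
    _ ≤ ε M * η := mul_le_mul_of_nonneg_left h2 hεM.le

end Summit.HubbardSuperconductivity.HubbardSuperconductivity.Theorems.TwoVolumeSource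

end
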